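import Summits.ResolutionOfSingularities.ResolutionOfSingularities.Theorems.DeltaCutSing2
import HarnessLib

/-!
# DeltaCutSing3 — tree file 3/6 of the decomp-res lens-6 g30 node «SingCut» (HOME `decomp-res-lens-6/g30/SingCut.lean` + `SingCutCertificates.lean`)

§SEngine — PERMISSIBILITY OF EVERY SINGULAR HOP PROVED (`support_singSurfCentre_subset`, `surfacePart_badClosure_subset_support`,
the limit-point lemma `support_oldSurfCentre_subset_support`, `sHop_facts`), ONE ENGINE FOR ALL HEIGHTS (`wor_of_sTerminatesAt`,
`wor_of_sTerminates`) and `sRun_facts`.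
The module docstring of `DeltaCutSing` (file 1/6) carries the node's summary (the law, the letters, the cells, the honest ceiling and
the sources); `NODE-g30.md` (HOME) is the record.  Same namespace `…Theorems.DeltaCutClasses`, declarations verbatim from the lens
file. [new] [folklore]
-/

noncomputable section

open CategoryTheory CategoryTheory.Limits AlgebraicGeometry TopologicalSpace IsLocalRing
open Literature.AlgebraicGeometry.Resolution

universe u

namespace Summit.ResolutionOfSingularities.ResolutionOfSingularities.Theorems.DeltaCutClasses

open Summit.ResolutionOfSingularities.ResolutionOfSingularities.Theorems.TwistCutClasses
open Summit.ResolutionOfSingularities.ResolutionOfSingularities.Theorems.LightCutClasses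

section SEngine

open Summit.ResolutionOfSingularities.ResolutionOfSingularities.Theorems
open WeakOrderReduction ForcedTowerClasses SubfieldContactClasses AbsoluteContactClasses PurityValveClasses
open Scheme.IdealSheafData (vanishingIdeal)

/-! ### §SEngine — PERMISSIBILITY OF BOTH STEPS PROVED (the limit-point lemma for the old surface part); ONE ENGINE FOR ALL
HEIGHTS -/

/-- **THE STEP-1 CENTRE LIES INSIDE THE TOP LOCUS**: `𝓘(closure Sing Σ_red)` is supported on `closure (Sing Σ_red) ⊆ Σ ⊆ closure
bad ⊆ Supp(𝓘,n)` (`singLocusOf_subset`, `surfacePart_subset`, g26's `closure_badLocus_subset_support`; the support is closed,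
`isClosed_support_of_isBase`). [new] [folklore] -/
theorem support_singSurfCentre_subset {k : Type} [Field k] {Y : Scheme.{0}} {g : Y ⟶ Spec (.of k)} (hB : IsBase Y g) {n : ℕ}
    {M : MarkedIdeal Y} (hM : IsDatum n M) :
    ((singCentreOf (surfacePart (badClosure n ⟨Y, M.ideal⟩))).support : Set Y) ⊆ M.support := by
  rw [coe_support_singCentreOf_surfacePart]
  exact closure_minimal
    ((singLocusOf_subset _).trans ((surfacePart_subset _).trans (closure_badLocus_subset_support hB hM)))
    (isClosed_support_of_isBase hB M)

/-- the old surface part lies inside the support. [folklore] -/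
theorem surfacePart_badClosure_subset_support {k : Type} [Field k] {Y : Scheme.{0}} {g : Y ⟶ Spec (.of k)} (hB : IsBase Y g)
    {n : ℕ} {M : MarkedIdeal Y} (hM : IsDatum n M) :
    ((surfacePart (badClosure n ⟨Y, M.ideal⟩) : Set Y)) ⊆ M.support :=
  (surfacePart_subset _).trans (closure_badLocus_subset_support hB hM)

/-- **PERMISSIBILITY OF STEP 2 — THE LIMIT-POINT LEMMA FOR THE OLD SURFACE PART (proved, not remarked)**: for a base `n`-datum
whose step-1 centre is regular, the step-2 centre — the closure of `π₁⁻¹(Σ ∖ closure Sing Σ_red)`, the strict transform of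
the OLD surface part — lies INSIDE THE TOP LOCUS of the transformed datum: off the centre the order is transported
(`IsBlowup.idealOrder_controlledTransform_of_not_mem`) and equals `n` on `Σ ⊆ Supp` (`idealOrder_eq_of_mem_support`), and the
LIMIT POINTS on the exceptional divisor are caught because the support upstairs is CLOSED (`orderUSC_holds` over the new base
`baseStable_holds`). [new] [folklore] -/
theorem support_oldSurfCentre_subset_support {k : Type} [Field k] {Y : Scheme.{0}} {g : Y ⟶ Spec (.of k)} (hB : IsBase Y g)
    {n : ℕ} {M : MarkedIdeal Y} (hM : IsDatum n M)
    (hC₁reg : Scheme.IsRegular (singCentreOf (surfacePart (badClosure n ⟨Y, M.ideal⟩))).subscheme) :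
    ((oldSurfCentre n ⟨Y, M.ideal⟩).support : Set _) ⊆
      (M.transform (blowup.π (singCentreOf (surfacePart (badClosure n ⟨Y, M.ideal⟩))))
        (singCentreOf (surfacePart (badClosure n ⟨Y, M.ideal⟩)))).support := by
  have hB₁ : IsBase (blowup (singCentreOf (surfacePart (badClosure n ⟨Y, M.ideal⟩))))
      (blowup.π (singCentreOf (surfacePart (badClosure n ⟨Y, M.ideal⟩))) ≫ g) :=
    baseStable_holds k Y g hB _ hC₁reg
  rw [coe_support_oldSurfCentre]
  refine closure_minimal (fun y' hy' => ?_) (isClosed_support_of_isBase hB₁ _)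
  obtain ⟨hyS, hyC⟩ := hy'
  have hy'C : (blowup.π (singCentreOf (surfacePart (badClosure n ⟨Y, M.ideal⟩)))).base y' ∉
      ((singCentreOf (surfacePart (badClosure n ⟨Y, M.ideal⟩))).support : Set Y) := by
    rw [coe_support_singCentreOf_surfacePart]; exact hyC
  show ((M.transform _ _).mult : ℕ∞) ≤ idealOrder (M.transform _ _).ideal y'
  rw [MarkedIdeal.transform_mult, MarkedIdeal.transform_ideal, hM.1,
    (blowup.isBlowup _).idealOrder_controlledTransform_of_not_mem M.ideal n hy'C,
    idealOrder_eq_of_mem_support hM (surfacePart_badClosure_subset_support hB hM hyS)]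

/-- **THE FACTS OF ONE SINGULAR HOP OF A BASE DATUM** (nothing pending, or a pending curve inside its support; all branches:
fire with step 2 / fire without step 2 / g28's graded hop): the next singular stage is again a base `n`-datum (nothing
pending, or a pending curve inside its support), EVERY CENTRE BLOWN UP IS REGULAR AND INSIDE THE TOP LOCUS — at a firing stage
the reduced Sing-closure of the surface part (regular by the test `SingFrozen`, inside the support by
`support_singSurfCentre_subset`) and then the reduced strict transform of the old surface part (regular by the test
`OldSurfRegular`, inside the NEW support by `support_oldSurfCentre_subset_support`), elsewhere g28's `gHop_facts` VERBATIM —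
and a weak resolution of the next datum splices to one of the present datum (`blowup_facts`, twice). [new] [folklore] -/
theorem sHop_facts {k : Type} [Field k] {Y : Scheme.{0}} {g : Y ⟶ Spec (.of k)} (hB : IsBase Y g) {n : ℕ}
    {M : MarkedIdeal Y} (hM : IsDatum n M) (P : Option (Closeds Y))
    (hP : ∀ S, P = some S → DimLEOne S ∧ (S : Set Y) ⊆ M.support) :
    ∃ (Y₁ : Scheme.{0}) (g₁ : Y₁ ⟶ Spec (.of k)) (M₁ : MarkedIdeal Y₁) (P₁ : Option (Closeds Y₁)),
      IsBase Y₁ g₁ ∧ IsDatum n M₁ ∧ (sHop n ⟨⟨Y, M.ideal⟩, P⟩).next = ⟨⟨Y₁, M₁.ideal⟩, P₁⟩ ∧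
      (∀ S₁, P₁ = some S₁ → DimLEOne S₁ ∧ (S₁ : Set Y₁) ⊆ M₁.support) ∧
      ((∃ t', WeakResolution t' M₁) → ∃ t : CentreSeq Y, WeakResolution t M) := by
  by_cases hs : SingNow n ⟨⟨Y, M.ideal⟩, P⟩
  · -- FIRE: step 1 (the reduced Sing-closure of the surface part), then step 2 if the old surface part's strict transform is
    -- regular; nothing pending afterwards
    obtain ⟨hPn, hS⟩ := hs
    have hPn' : P = none := hPn
    subst hPn'
    haveI : IsLocallyNoetherian Y := isLocallyNoetherian_of_isBase hB
    obtain ⟨hB₁, hM₁, hI₁, hsp₁⟩ := blowup_facts hB hM (singCentreOf (surfacePart (badClosure n ⟨Y, M.ideal⟩))) hS.2.2.2.2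
      (support_singSurfCentre_subset hB hM)
    haveI : IsLocallyNoetherian (blowup (singCentreOf (surfacePart (badClosure n ⟨Y, M.ideal⟩)))) :=
      isLocallyNoetherian_of_isBase hB₁
    by_cases hreg₂ : OldSurfRegular n ⟨Y, M.ideal⟩
    · obtain ⟨hB₂, hM₂, hI₂, hsp₂⟩ := blowup_facts hB₁ hM₁ (oldSurfCentre n ⟨Y, M.ideal⟩) hreg₂
        (support_oldSurfCentre_subset_support hB hM hS.2.2.2.2)
      refine ⟨blowup (oldSurfCentre n ⟨Y, M.ideal⟩),
        blowup.π (oldSurfCentre n ⟨Y, M.ideal⟩) ≫ blowup.π _ ≫ g,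
        (M.transform (blowup.π (singCentreOf (surfacePart (badClosure n ⟨Y, M.ideal⟩))))
            (singCentreOf (surfacePart (badClosure n ⟨Y, M.ideal⟩)))).transform
          (blowup.π (oldSurfCentre n ⟨Y, M.ideal⟩)) (oldSurfCentre n ⟨Y, M.ideal⟩),
        none, hB₂, hM₂, ?_, fun S₁ h => (Option.some_ne_none S₁ h.symm).elim, fun h => hsp₁ (hsp₂ h)⟩
      rw [sHop_next_of_regular ⟨hPn, hS⟩ hreg₂]
      show (⟨singStepTwo n ⟨Y, M.ideal⟩, none⟩ : RefStage) = _
      rw [MarkedIdeal.transform_ideal, MarkedIdeal.transform_mult, MarkedIdeal.transform_ideal, hM.1]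
    · refine ⟨blowup (singCentreOf (surfacePart (badClosure n ⟨Y, M.ideal⟩))), blowup.π _ ≫ g,
        M.transform (blowup.π (singCentreOf (surfacePart (badClosure n ⟨Y, M.ideal⟩))))
          (singCentreOf (surfacePart (badClosure n ⟨Y, M.ideal⟩))),
        none, hB₁, hM₁, ?_, fun S₁ h => (Option.some_ne_none S₁ h.symm).elim, hsp₁⟩
      rw [sHop_next_of_not_regular ⟨hPn, hS⟩ hreg₂]
      show (⟨singStepOne n ⟨Y, M.ideal⟩, none⟩ : RefStage) = _
      rw [MarkedIdeal.transform_ideal, hM.1]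
  · rw [sHop_eq_gHop hs]
    exact gHop_facts hB hM P hP

/-- **THE SINGULAR ENGINE, ITERATED (one theorem for ALL heights).**  For every `h`: a base `n`-datum, with nothing pending or a
pending curve inside its support, whose singular run MOVES below level `h` and has NOTHING PENDING and EMPTY bad locus at
level `h` has a weak resolution, given `SeqDimFour 5 n` — induction on `h` (`h = 0`: g28's engine at height `0` = g23's
closing law; `h + 1`: `sHop_facts` + the tail identity `sRun_succ_front` + the splice). [new] [folklore] -/
theorem wor_of_sTerminatesAt {n : ℕ} (hn : 1 ≤ n) (h5 : SeqDimFour 5 n) (p : ℕ) (hp : p.Prime) (k : Type) [Field k]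
    [CharP k p] : ∀ (h : ℕ) (Y : Scheme.{0}) (g : Y ⟶ Spec (.of k)), IsBase Y g → ∀ M : MarkedIdeal Y, IsDatum n M →
      ∀ P : Option (Closeds Y), (∀ S, P = some S → DimLEOne S ∧ (S : Set Y) ⊆ M.support) →
      (∀ j < h, SMoves n (sRun n ⟨⟨Y, M.ideal⟩, P⟩ j)) → (sRun n ⟨⟨Y, M.ideal⟩, P⟩ h).pending = none →
      BadEmpty n (sRun n ⟨⟨Y, M.ideal⟩, P⟩ h).base → ∃ t : CentreSeq Y, WeakResolution t M := by
  intro h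
  induction h with
  | zero =>
    intro Y g hB M hM P hP _ hpend hemp
    exact wor_of_gTerminatesAt hn h5 p hp k 0 Y g hB M hM P hP (fun j hj => (Nat.not_lt_zero j hj).elim) hpend hemp
  | succ h ih =>
    intro Y g hB M hM P hP hpre hpend hemp
    obtain ⟨Y₁, g₁, M₁, P₁, hB₁, hM₁, hS, hP₁, hsp⟩ := sHop_facts hB hM P hP
    have e : ∀ j, sRun n ⟨⟨Y, M.ideal⟩, P⟩ (j + 1) = sRun n ⟨⟨Y₁, M₁.ideal⟩, P₁⟩ j := fun j => by
      rw [sRun_succ_front, hS]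
    refine hsp (ih Y₁ g₁ hB₁ M₁ hM₁ P₁ hP₁ (fun j hj => ?_) ?_ ?_)
    · have := hpre (j + 1) (Nat.succ_lt_succ hj); rwa [e] at this
    · have := hpend; rwa [e] at this
    · have := hemp; rwa [e] at this

/-- **THE SINGULAR ENGINE · the decided cell closes**: a base `n`-datum whose singular run TERMINATES has a weak resolution, given
`SeqDimFour 5 n`. [new] [folklore] -/
theorem wor_of_sTerminates {n : ℕ} (hn : 1 ≤ n) (h5 : SeqDimFour 5 n) (p : ℕ) (hp : p.Prime) (k : Type) [Field k]
    [CharP k p] (Y : Scheme.{0}) (g : Y ⟶ Spec (.of k)) (hB : IsBase Y g) (M : MarkedIdeal Y) (hM : IsDatum n M)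
    (hS : STerminates n ⟨⟨Y, M.ideal⟩, none⟩) : ∃ t : CentreSeq Y, WeakResolution t M := by
  obtain ⟨h, hpre, hpend, hemp⟩ := hS
  exact wor_of_sTerminatesAt hn h5 p hp k h Y g hB M hM none (fun S h => (Option.some_ne_none S h.symm).elim) hpre hpend hemp

/-- **EVERY LEVEL OF THE SINGULAR RUN OF A BASE DATUM IS A BASE DATUM** (with nothing pending or a pending curve inside its
support). [new] [folklore] -/
theorem sRun_facts {k : Type} [Field k] {Y : Scheme.{0}} {g : Y ⟶ Spec (.of k)} (hB : IsBase Y g) {n : ℕ}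
    {M : MarkedIdeal Y} (hM : IsDatum n M) (P : Option (Closeds Y))
    (hP : ∀ S, P = some S → DimLEOne S ∧ (S : Set Y) ⊆ M.support) : ∀ i : ℕ,
    ∃ (Yᵢ : Scheme.{0}) (gᵢ : Yᵢ ⟶ Spec (.of k)) (Mᵢ : MarkedIdeal Yᵢ) (Pᵢ : Option (Closeds Yᵢ)),
      IsBase Yᵢ gᵢ ∧ IsDatum n Mᵢ ∧ sRun n ⟨⟨Y, M.ideal⟩, P⟩ i = ⟨⟨Yᵢ, Mᵢ.ideal⟩, Pᵢ⟩ ∧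
      (∀ Sᵢ, Pᵢ = some Sᵢ → DimLEOne Sᵢ ∧ (Sᵢ : Set Yᵢ) ⊆ Mᵢ.support)
  | 0 => ⟨Y, g, M, P, hB, hM, rfl, hP⟩
  | i + 1 => by
    obtain ⟨Yᵢ, gᵢ, Mᵢ, Pᵢ, hBᵢ, hMᵢ, e, hPᵢ⟩ := sRun_facts hB hM P hP i
    obtain ⟨Y₁, g₁, M₁, P₁, hB₁, hM₁, hS, hP₁, -⟩ := sHop_facts hBᵢ hMᵢ Pᵢ hPᵢ
    exact ⟨Y₁, g₁, M₁, P₁, hB₁, hM₁, by rw [sRun_succ, e, hS], hP₁⟩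

end SEngine

end Summit.ResolutionOfSingularities.ResolutionOfSingularities.Theorems.DeltaCutClasses
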